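import Literature.AlgebraicGeometry.Resolution.RationalFunctionsToProjectiveSpace
import Literature.AlgebraicGeometry.Motives.FunctionFieldOver
import HarnessLib

/-!
# Generating sections read in the function field

Topic `Literature/AlgebraicGeometry/Motives`; theorem-only. For generating-sections data `D` on an
integral scheme `Y` (sections `sᵢ` of a line bundle, recorded through the opens `U i = Y_{sᵢ}`
and the ratios `D.ratio i j = s_j/s_i ∈ Γ(Y, U i)`), the rational functions `[s_j/s_i] ∈ K(Y)`
satisfy the cocycle identity `[s_j/s_i] · [s_l/s_j] = [s_l/s_i]` and are non-zero as soon as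
`U j ≠ ∅`; hence all ratios are quotients `[s_j/s_{i₀}] / [s_i/s_{i₀}]` of the ratios over one
base chart. (The `appLE` form of `RatFn.functionFieldMap_ofSection` is the one-line rewrite
`rw [Scheme.Hom.appLE, CommRingCat.comp_apply, ofSection_map, functionFieldMap_ofSection]`,
landed as `CartierDivisor.CechCover.ofSection_appLE`.)

## References

* R. Hartshorne, *Algebraic Geometry* (1977), II Thm. 7.1 (proof). [Hartshorne1977]
-/

noncomputable section

universe u

open CategoryTheory AlgebraicGeometry TopologicalSpace Opposite
open Literature.AlgebraicGeometry.Resolution (ofSection_mul ofSection_one ofSection_zero)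

namespace Literature.AlgebraicGeometry.Motives

namespace RatFn

/-- A section over a non-empty open of an integral scheme has non-zero rational function iff its
basic open is non-empty, i.e. contains the generic point. [folklore] -/
theorem ofSection_ne_zero_iff {X : Scheme.{u}} [IsIntegral X] {U : X.Opens}
    (hU : genericPoint X ∈ U) (σ : Γ(X, U)) :
    ofSection hU σ ≠ 0 ↔ genericPoint X ∈ X.basicOpen σ := by
  constructor
  · intro h
    by_contra hξ
    have hbot : X.basicOpen σ = ⊥ := by
      by_contra hne
      have hne' : ((X.basicOpen σ : X.Opens) : Set X).Nonempty := by
        rw [Set.nonempty_iff_ne_empty]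
        exact fun h' ↦ hne (Opens.ext h')
      exact hξ (genericPoint_mem_of_mem hne'.some_mem)
    rw [basicOpen_eq_bot_iff] at hbot
    exact h (by rw [hbot, ofSection_zero])
  · intro h
    exact ((isUnitAt_ofSection_iff hU σ).mpr h).ne_zero

end RatFn

namespace GeneratingSections

variable {ι : Type} {Y : Scheme.{u}} [IsIntegral Y] (D : GeneratingSections ι Y)

/-- **The cocycle identity in the function field**: `[s_j/s_i] · [s_l/s_j] = [s_l/s_i]`.
[cite: Hartshorne1977, II Thm. 7.1 (proof)] -/
theorem ofSection_ratio_mul_ofSection_ratio {i j : ι} (hi : genericPoint Y ∈ D.U i)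
    (hj : genericPoint Y ∈ D.U j) (l : ι) :
    RatFn.ofSection hi (D.ratio i j) * RatFn.ofSection hj (D.ratio j l) =
      RatFn.ofSection hi (D.ratio i l) := by
  have hij : genericPoint Y ∈ D.U i ⊓ D.U j := ⟨hi, hj⟩
  have h := congrArg (RatFn.ofSection hij) (D.ratio_mul_ratio i j l)
  rw [ofSection_mul] at h
  change RatFn.ofSection hij (Y.presheaf.map (homOfLE inf_le_left).op (D.ratio i j)) *
      RatFn.ofSection hij (Y.presheaf.map (homOfLE inf_le_right).op (D.ratio j l)) =
    RatFn.ofSection hij (Y.presheaf.map (homOfLE inf_le_left).op (D.ratio i l)) at h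
  rwa [RatFn.ofSection_map, RatFn.ofSection_map, RatFn.ofSection_map] at h

/-- `[s_j/s_i] ≠ 0` when the chart `U j` is non-empty. [folklore] -/
theorem ofSection_ratio_ne_zero {i j : ι} (hi : genericPoint Y ∈ D.U i)
    (hj : genericPoint Y ∈ D.U j) : RatFn.ofSection hi (D.ratio i j) ≠ 0 := by
  rw [RatFn.ofSection_ne_zero_iff, D.basicOpen_ratio]
  exact ⟨hi, hj⟩

/-- **All ratios from one base chart**: `[s_l/s_j] = [s_l/s_i] / [s_j/s_i]`. [folklore] -/
theorem ofSection_ratio_eq_div {i j : ι} (hi : genericPoint Y ∈ D.U i)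
    (hj : genericPoint Y ∈ D.U j) (l : ι) :
    RatFn.ofSection hj (D.ratio j l) =
      RatFn.ofSection hi (D.ratio i l) / RatFn.ofSection hi (D.ratio i j) := by
  rw [eq_div_iff (D.ofSection_ratio_ne_zero hi hj), mul_comm]
  exact D.ofSection_ratio_mul_ofSection_ratio hi hj l

/-- `[s_i/s_j] = [s_j/s_i]⁻¹`. [folklore] -/
theorem ofSection_ratio_symm {i j : ι} (hi : genericPoint Y ∈ D.U i)
    (hj : genericPoint Y ∈ D.U j) :
    RatFn.ofSection hj (D.ratio j i) = (RatFn.ofSection hi (D.ratio i j))⁻¹ := by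
  rw [D.ofSection_ratio_eq_div hi hj i, D.ratio_self, ofSection_one, one_div]

end GeneratingSections

end Literature.AlgebraicGeometry.Motives

end
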